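import Summits.BirchSwinnertonDyer.Rank1Residual.ManinAdditive.ManinCongruenceDefectLaw
import Summits.BirchSwinnertonDyer.Rank1Residual.ManinConstantOne
import HarnessLib

/-!
# Placement edges of candidate E-desc-2 `ManinCongruenceDefectLaw` (cell bsd-f2-manin) — PROVED

* `maninCongruenceDefectLaw_of_maninConstantOne_of_ars` : Manin's conjecture ∧ ARS 2012 Conj. 2.2
  (both registered conjectures of the tree) ⟹ the law;
* `two_mul_padicValInt_maninConstant_le_of_law` : the law ∧ Ribet's `m_E ∣ r_E` (tree fact
  `modularDegree_dvd_congruenceNumber`, as a hypothesis) ∧ `r_E ≠ 0` ⟹ `2·ord_p(c_E) ≤ ord_p(N)`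
  for the optimal minimal-degree datum — the EFFECTIVE absolute bound the law would give
  (`ord₂(c_E) ≤ 4`, `ord₃(c_E) ≤ 2`, `ord_p(c_E) ≤ 1` for `p ≥ 5`).
Nothing else is claimed; no fact is introduced.
-/

noncomputable section

open scoped MatrixGroups ModularForm

open CongruenceSubgroup WeierstrassCurve
  Literature.NumberTheory.EllipticCurves.ModularForms
  Summit.BirchSwinnertonDyer.Rank1Residual.ManinConstant

namespace Summit.BirchSwinnertonDyer.Rank1Residual.ManinAdditive

/-- **Manin ∧ ARS Conj. 2.2 ⟹ E-desc-2**: under `ManinConstantOne` the Manin term vanishes on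
optimal data, and the remaining inequality is `AgasheRibetStein2012_conjecture` at the level
`N = W.conductorNorm ℤ`. -/
theorem maninCongruenceDefectLaw_of_maninConstantOne_of_ars (hM : ManinConstantOne)
    (hARS : AgasheRibetStein2012_conjecture) : ManinCongruenceDefectLaw := by
  intro W _ _ _ D hopt hmin p hp
  haveI : Fact p.Prime := ⟨hp⟩
  have h1 : |D.maninConstant| = 1 := hM W D hopt
  have hnd : ¬ (p : ℤ) ∣ D.maninConstant := by
    intro hdvd
    have h2 : (p : ℤ) ∣ 1 := h1 ▸ (dvd_abs _ _).mpr hdvd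
    have h3 : (p : ℤ) = 1 := Int.eq_one_of_dvd_one (by positivity) h2
    exact hp.one_lt.ne' (by exact_mod_cast h3)
  rw [padicValInt.eq_zero_of_not_dvd hnd, zero_add]
  exact hARS W (W.conductorNorm ℤ) D hmin p hp

/-- **E-desc-2 ⟹ `2·ord_p(c_E) ≤ ord_p(N)`** for an optimal minimal-degree datum at the conductor
level, granted Ribet's divisibility `m_E ∣ r_E` (tree fact `modularDegree_dvd_congruenceNumber`)
and `r_E ≠ 0` (so that `ord_p(m_E) ≤ ord_p(r_E)`). -/
theorem two_mul_padicValInt_maninConstant_le_of_law (hF : ManinCongruenceDefectLaw)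
    (hRibet : modularDegree_dvd_congruenceNumber)
    (W : WeierstrassCurve ℚ) [W.IsElliptic] [W.IsGloballyMinimal] [NeZero (W.conductorNorm ℤ)]
    (D : ModularParametrizationData W (W.conductorNorm ℤ))
    (hopt : ∀ z ∈ D.L.lattice, ∃ w ∈ periodLattice D.f, z = D.c * w)
    (hmin : ∀ (W' : WeierstrassCurve ℚ) [W'.IsElliptic]
      (D' : ModularParametrizationData W' (W.conductorNorm ℤ)),
      D'.f = D.f → D.modularDegree ≤ D'.modularDegree)
    (hr : congruenceNumber D.f ≠ 0) {p : ℕ} (hp : p.Prime) :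
    2 * padicValInt p D.maninConstant ≤ padicValNat p (W.conductorNorm ℤ) := by
  haveI : Fact p.Prime := ⟨hp⟩
  have hlaw := hF W D hopt hmin p hp
  have hdvd : D.modularDegree ∣ congruenceNumber D.f := hRibet W (W.conductorNorm ℤ) D hmin
  have hle : padicValNat p D.modularDegree ≤ padicValNat p (congruenceNumber D.f) :=
    (padicValNat_dvd_iff_le hr).1 (dvd_trans pow_padicValNat_dvd hdvd)
  omega

end Summit.BirchSwinnertonDyer.Rank1Residual.ManinAdditive

end
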